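import Mathlib.Analysis.Convex.Basic
import Literature.Probability.LatticeModels.DomainDiscretisation
import HarnessLib

/-!
# Cell domains: planar domains tiled by corner-cut cells of `δℤ²`

Topic `Literature/Probability/LatticeModels` (definition item `defn-CellDomain`, wanted by the
cruxes `TurningClosure` / `SchrammPassageUniform` of route SAWSchrammPassage of
`Summits/CriticalPhenomena/SAWScalingLimit`, items `stmt-CriticalPhenomena-5595/5596`, which
inline the notion verbatim as `D.carrier = interior {w : ℂ | ∃ v ∈ S, …}`).

Statements about lattice interfaces "uniformly over discrete domains" (Smirnov-type theorems;
for the self-avoiding walk Lawler–Schramm–Werner 2004, §3.4; for the Ising model the *polygonal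
domain* `Ω^δ` of a discrete domain, Chelkak–Smirnov 2012, §4: the union of the closed faces
around its vertices) need, for every finite vertex set `S ⊆ ℤ²`, a planar domain whose
canonical discretisation (`meshVertices`, `meshDomain`, `discreteDomainGraph` of
`DomainDiscretisation.lean`) gives back exactly `S` with its induced nearest-neighbour edges,
and which stays in the same class when the domain is slit along a lattice path. The plain union
of the closed `δ`-squares around the points of `S` fails at *pinch points*: two diagonal
neighbours `v, v + (1,1) ∈ S` whose two common neighbours are missing from `S` have squares
meeting at exactly one corner. The remedy used by the route cuts the corners: the cell of `v` is
the closed octagon `|x| ≤ δ/2`, `|y| ≤ δ/2`, `|x| + |y| ≤ 9δ/10` in coordinates centred at the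
mesh point `δv`; horizontally or vertically adjacent cells share a side of length `4δ/5`, while
cells of distinct non-adjacent sites are disjoint (`disjoint_cutCell`), so no pinching occurs.
(The tree's `meshCell δ x` / `meshPolygon Λ δ` of `PlanarIsingOnePoint.lean` are the UNCUT closed
square faces and their polygonal domain, Chelkak–Hongler–Izyurov's convention for the Ising
model; `cutCell δ v ⊆ meshCell δ v` and `CellDomain S δ ⊆ meshPolygon ↑S δ`, not restated here to
keep this file free of the Ising imports.)

## Contents (namespace `Literature.Probability.LatticeModels`)

* `cutCell δ v` — the closed corner-cut cell of the site `v` at mesh `δ` (convex, closed,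
  inside `closedBall (δv) (9δ/10)`, containing `ball (δv) (2δ/5)`), with
  `eq_of_meshPoint_mem_cutCell` and the no-pinching lemma `disjoint_cutCell`.
* `CellDomain S δ := interior (⋃ v ∈ S, cutCell δ v)` — **the cell domain of a finite
  `S ⊆ ℤ²`**; `cellDomain_eq_interior_setOf` is the verbatim form inlined in the route items.
* Topology: `isOpen_cellDomain`, `isBounded_cellDomain`, `closure_cellDomain_subset`,
  `cellDomain_mono`, `cellDomain_eq_empty` (junk: `δ ≤ 0`), `cellDomain_nonempty_iff`.
* Mesh vertices (`0 < δ`): `meshPoint_mem_cellDomain`, `mem_meshVertices_cellDomain_iff`,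
  `meshVertices_cellDomain` (**`meshVertices (CellDomain S δ) δ = S`**).

The companion file `CellDomainDiscretisation.lean` proves that closed mesh edges of `S` lie in the
domain, that `meshDomain (CellDomain S δ) δ = S` and `discreteDomainGraph (CellDomain S δ) δ` is
the subgraph of `ℤ²` induced on `S` when the latter is connected, and that the cell domain is
then connected.

## What is NOT here (further items; not needed to *state* the route cruxes)

* The Jordan-curve structure of `∂(CellDomain S δ)` for simply connected `S` (one closed
  lattice-octagon polygon) and the resulting `DobrushinDomain` with marks at the side midpoints
  `(δp + δp')/2`, `p ∈ S`, `p' ∉ S` adjacent: this needs a polygonal Jordan curve theorem.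
* Stability under SAW slitting and the domain Markov property of `SAW.law` in cell domains
  (belongs with `RandomPlanarGeometry/SelfAvoidingWalk.lean`).

## References

* D. Chelkak, S. Smirnov, *Universality in the 2D Ising model and conformal invariance of
  fermionic observables*, Invent. Math. 189 (2012), §4 (the polygonal domain `Ω^δ` of a
  discrete domain).
* G. F. Lawler, O. Schramm, W. Werner, *On the scaling limit of planar self-avoiding walk*,
  Proc. Sympos. Pure Math. 72 (2004), §3.4 (SAW measures in lattice domains).
* S. Smirnov, *Critical percolation in the plane*, C. R. Acad. Sci. Paris 333 (2001), §2.

Mathlib anchors: `interior`, `Convex`, `Metric.ball`, `Bornology.IsBounded`,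
`infinite_of_mem_nhds`. Mathlib has no lattice cells or polygonal lattice domains (searched
`cutCell`, `CellDomain`, `polygonalDomain`, `latticeCell`, `pixel`).
-/

noncomputable section

open Set Metric Complex

namespace Literature.Probability.LatticeModels

variable {S T : Finset (Site 2)} {δ : ℝ} {u v : Site 2} {w : ℂ}

/-! ### Corner-cut cells -/

/-- The closed **corner-cut cell** of the site `v ∈ ℤ²` at mesh `δ`: the octagon of points `w`
with `|Re (w − δv)| ≤ δ/2`, `|Im (w − δv)| ≤ δ/2` and `|Re (w − δv)| + |Im (w − δv)| ≤ 9δ/10`,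
i.e. the closed `δ`-square centred at the mesh point `meshPoint δ v` with its four corners cut
off along the lines `|x| + |y| = 9δ/10` (so that diagonal cells do not touch). Empty for
`δ < 0` and the singleton `{0}` for `δ = 0` (junk). A corner-cut variant of the closed square
face of the polygonal domain of Chelkak–Smirnov 2012, §4. [folklore] -/
def cutCell (δ : ℝ) (v : Site 2) : Set ℂ :=
  {w | |w.re - (meshPoint δ v).re| ≤ δ / 2 ∧ |w.im - (meshPoint δ v).im| ≤ δ / 2 ∧
    |w.re - (meshPoint δ v).re| + |w.im - (meshPoint δ v).im| ≤ 9 * δ / 10}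

/-- Membership in a corner-cut cell, unfolded. [folklore] -/
theorem mem_cutCell_iff : w ∈ cutCell δ v ↔
    |w.re - (meshPoint δ v).re| ≤ δ / 2 ∧ |w.im - (meshPoint δ v).im| ≤ δ / 2 ∧
      |w.re - (meshPoint δ v).re| + |w.im - (meshPoint δ v).im| ≤ 9 * δ / 10 :=
  Iff.rfl

/-- The mesh point `δv` is the centre of its cell (for `δ ≥ 0`). [folklore] -/
theorem meshPoint_mem_cutCell (hδ : 0 ≤ δ) (v : Site 2) : meshPoint δ v ∈ cutCell δ v := by
  simp only [mem_cutCell_iff, sub_self, abs_zero, add_zero]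
  exact ⟨by linarith, by linarith, by linarith⟩

/-- A cell lies in the closed disc of radius `9δ/10` about its centre. [folklore] -/
theorem cutCell_subset_closedBall (δ : ℝ) (v : Site 2) :
    cutCell δ v ⊆ closedBall (meshPoint δ v) (9 * δ / 10) := by
  rintro w ⟨-, -, h⟩
  rw [mem_closedBall, Complex.dist_eq]
  refine (norm_le_abs_re_add_abs_im _).trans ?_
  simpa only [sub_re, sub_im] using h

/-- The open disc of radius `2δ/5` about the centre lies in the cell. [folklore] -/
theorem ball_subset_cutCell (δ : ℝ) (v : Site 2) :
    ball (meshPoint δ v) (2 * δ / 5) ⊆ cutCell δ v := by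
  intro w hw
  rw [mem_ball, Complex.dist_eq] at hw
  have h1 : |w.re - (meshPoint δ v).re| < 2 * δ / 5 := by
    simpa only [sub_re] using (abs_re_le_norm (w - meshPoint δ v)).trans_lt hw
  have h2 : |w.im - (meshPoint δ v).im| < 2 * δ / 5 := by
    simpa only [sub_im] using (abs_im_le_norm (w - meshPoint δ v)).trans_lt hw
  have h0 : 0 ≤ |w.re - (meshPoint δ v).re| := abs_nonneg _
  exact ⟨by linarith, by linarith, by linarith⟩

/-- A cell is closed. [folklore] -/
theorem isClosed_cutCell (δ : ℝ) (v : Site 2) : IsClosed (cutCell δ v) := by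
  simp only [cutCell, setOf_and]
  refine (isClosed_le ?_ continuous_const).inter
    ((isClosed_le ?_ continuous_const).inter (isClosed_le ?_ continuous_const))
  · exact continuous_abs.comp (continuous_re.sub continuous_const)
  · exact continuous_abs.comp (continuous_im.sub continuous_const)
  · exact (continuous_abs.comp (continuous_re.sub continuous_const)).add
      (continuous_abs.comp (continuous_im.sub continuous_const))

/-- A cell is convex (an intersection of eight closed half-planes). [folklore] -/
theorem convex_cutCell (δ : ℝ) (v : Site 2) : Convex ℝ (cutCell δ v) := by
  rintro x ⟨hx1, hx2, hx3⟩ y ⟨hy1, hy2, hy3⟩ a b ha hb hab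
  have key : ∀ p q r : ℝ, |a * p + b * q - r| ≤ a * |p - r| + b * |q - r| := fun p q r => by
    have e : a * p + b * q - r = a * (p - r) + b * (q - r) := by
      linear_combination r * hab
    rw [e]
    refine (abs_add_le _ _).trans (le_of_eq ?_)
    rw [abs_mul, abs_mul, abs_of_nonneg ha, abs_of_nonneg hb]
  have h1 := key x.re y.re (meshPoint δ v).re
  have h2 := key x.im y.im (meshPoint δ v).im
  simp only [mem_cutCell_iff, add_re, add_im, smul_re, smul_im, smul_eq_mul]
  refine ⟨h1.trans ?_, h2.trans ?_, (add_le_add h1 h2).trans ?_⟩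
  · nlinarith
  · nlinarith
  · nlinarith

/-- For `δ > 0`, the mesh point `δu` lies in the cell of `v` only if `u = v` (distinct mesh
points are `≥ δ` apart in sup norm). [folklore] -/
theorem eq_of_meshPoint_mem_cutCell (hδ : 0 < δ) (h : meshPoint δ u ∈ cutCell δ v) :
    u = v := by
  obtain ⟨h1, h2, -⟩ := h
  rw [meshPoint_re, meshPoint_re, ← mul_sub, abs_mul, abs_of_pos hδ] at h1
  rw [meshPoint_im, meshPoint_im, ← mul_sub, abs_mul, abs_of_pos hδ] at h2
  have k1 : |((u 0 - v 0 : ℤ) : ℝ)| < 1 := by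
    push_cast; nlinarith [abs_nonneg ((u 0 : ℝ) - v 0)]
  have k2 : |((u 1 - v 1 : ℤ) : ℝ)| < 1 := by
    push_cast; nlinarith [abs_nonneg ((u 1 : ℝ) - v 1)]
  have k1' : |u 0 - v 0| < 1 := by exact_mod_cast k1
  have k2' : |u 1 - v 1| < 1 := by exact_mod_cast k2
  rw [Int.abs_lt_one_iff, sub_eq_zero] at k1' k2'
  ext i
  fin_cases i
  · exact k1'
  · exact k2'

/-- **No pinch points.** For `δ > 0` the cells of two distinct non-adjacent sites of `ℤ²` are
disjoint: the squares of sites at sup-distance `≥ 2` are already disjoint, and the cut corners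
separate the cells of diagonal neighbours. [folklore] -/
theorem disjoint_cutCell (hδ : 0 < δ) (huv : u ≠ v) (hadj : ¬ (zdGraph 2).Adj u v) :
    Disjoint (cutCell δ u) (cutCell δ v) := by
  rw [Set.disjoint_left]
  rintro w ⟨hu1, hu2, hu3⟩ ⟨hv1, hv2, hv3⟩
  rw [meshPoint_re] at hu1 hv1 hu3 hv3
  rw [meshPoint_im] at hu2 hv2 hu3 hv3
  -- triangle inequalities between the two centres through `w`
  have t0 := abs_sub_le (δ * (u 0 : ℝ)) w.re (δ * (v 0 : ℝ))
  have t1 := abs_sub_le (δ * (u 1 : ℝ)) w.im (δ * (v 1 : ℝ))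
  rw [abs_sub_comm (δ * (u 0 : ℝ)) w.re, ← mul_sub, abs_mul, abs_of_pos hδ] at t0
  rw [abs_sub_comm (δ * (u 1 : ℝ)) w.im, ← mul_sub, abs_mul, abs_of_pos hδ] at t1
  -- hence the integer coordinates differ by at most one
  have d0 : |u 0 - v 0| ≤ 1 := by
    have : |((u 0 - v 0 : ℤ) : ℝ)| ≤ 1 := by
      push_cast
      exact le_of_mul_le_mul_left (by linarith) hδ
    exact_mod_cast this
  have d1 : |u 1 - v 1| ≤ 1 := by
    have : |((u 1 - v 1 : ℤ) : ℝ)| ≤ 1 := by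
      push_cast
      exact le_of_mul_le_mul_left (by linarith) hδ
    exact_mod_cast this
  rw [abs_le] at d0 d1
  -- `u ≠ v` not adjacent: both coordinates differ (by exactly one), i.e. diagonal neighbours
  have hne : ¬ (u 0 = v 0 ∧ u 1 = v 1) := fun h => huv (funext (Fin.forall_fin_two.2 h))
  rw [zdGraph_adj_iff, Fin.exists_fin_two] at hadj
  simp only [funext_iff, Fin.forall_fin_two, Pi.add_apply, Pi.single_eq_same,
    Pi.single_eq_of_ne (one_ne_zero : (1 : Fin 2) ≠ 0),
    Pi.single_eq_of_ne (zero_ne_one : (0 : Fin 2) ≠ 1), add_zero] at hadj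
  have e0 : |(u 0 : ℝ) - v 0| = 1 := by
    rcases (show u 0 - v 0 = 1 ∨ u 0 - v 0 = -1 by omega) with h | h
    · rw [show (u 0 : ℝ) - v 0 = 1 by exact_mod_cast h, abs_one]
    · rw [show (u 0 : ℝ) - v 0 = -1 by exact_mod_cast h, abs_neg, abs_one]
  have e1 : |(u 1 : ℝ) - v 1| = 1 := by
    rcases (show u 1 - v 1 = 1 ∨ u 1 - v 1 = -1 by omega) with h | h
    · rw [show (u 1 : ℝ) - v 1 = 1 by exact_mod_cast h, abs_one]
    · rw [show (u 1 : ℝ) - v 1 = -1 by exact_mod_cast h, abs_neg, abs_one]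
  -- at a common point both cells would be inside a cut corner
  rw [e0, mul_one] at t0
  rw [e1, mul_one] at t1
  linarith

/-! ### The cell domain -/

/-- The **cell domain** of a finite set of sites `S ⊆ ℤ²` at mesh `δ`: the interior of the union
of the closed corner-cut cells `cutCell δ v`, `v ∈ S`. For `δ > 0` it is a bounded open set
whose mesh vertices are exactly `S` (`meshVertices_cellDomain`), whose discretisation `Ω_δ` is
the subgraph of `ℤ²` induced on `S` as soon as that subgraph is connected
(`discreteDomainGraph_cellDomain`), and which is then connected (`isConnected_cellDomain`);
the corner cuts prevent pinch points (`disjoint_cutCell`). This is the class of domains over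
which the SAW cruxes of route SAWSchrammPassage are stated uniformly; a corner-cut variant of the
polygonal domain of a discrete domain (Chelkak–Smirnov 2012, §4). Empty for `δ ≤ 0`
(`cellDomain_eq_empty`, junk). [folklore] -/
def CellDomain (S : Finset (Site 2)) (δ : ℝ) : Set ℂ :=
  interior (⋃ v ∈ S, cutCell δ v)

/-- `CellDomain` unfolded to the form inlined in the route items `TurningClosure` /
`SchrammPassageUniform` (route SAWSchrammPassage). [folklore] -/
theorem cellDomain_eq_interior_setOf (S : Finset (Site 2)) (δ : ℝ) :
    CellDomain S δ = interior {w : ℂ | ∃ v ∈ S, |w.re - (meshPoint δ v).re| ≤ δ / 2 ∧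
      |w.im - (meshPoint δ v).im| ≤ δ / 2 ∧
      |w.re - (meshPoint δ v).re| + |w.im - (meshPoint δ v).im| ≤ 9 * δ / 10} := by
  rw [CellDomain]
  congr 1
  ext w
  simp only [mem_iUnion, exists_prop, mem_setOf_eq, mem_cutCell_iff]

/-- A cell domain is open. [folklore] -/
theorem isOpen_cellDomain (S : Finset (Site 2)) (δ : ℝ) : IsOpen (CellDomain S δ) :=
  isOpen_interior

/-- A cell domain lies in the union of its cells. [folklore] -/
theorem cellDomain_subset_iUnion (S : Finset (Site 2)) (δ : ℝ) :
    CellDomain S δ ⊆ ⋃ v ∈ S, cutCell δ v :=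
  interior_subset

/-- A point of the cell domain lies in the cell of some site of `S`. [folklore] -/
theorem exists_mem_cutCell_of_mem_cellDomain (hw : w ∈ CellDomain S δ) :
    ∃ v ∈ S, w ∈ cutCell δ v := by
  simpa only [mem_iUnion, exists_prop] using cellDomain_subset_iUnion S δ hw

/-- Cell domains are monotone in the set of sites. [folklore] -/
theorem cellDomain_mono (h : S ⊆ T) (δ : ℝ) : CellDomain S δ ⊆ CellDomain T δ :=
  interior_mono (biUnion_subset_biUnion_left fun _ hv => h hv)

/-- The union of the cells is closed (a finite union of closed sets). [folklore] -/
theorem isClosed_iUnion_cutCell (S : Finset (Site 2)) (δ : ℝ) :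
    IsClosed (⋃ v ∈ S, cutCell δ v) :=
  isClosed_biUnion_finset fun v _ => isClosed_cutCell δ v

/-- The union of the cells is bounded. [folklore] -/
theorem isBounded_iUnion_cutCell (S : Finset (Site 2)) (δ : ℝ) :
    Bornology.IsBounded (⋃ v ∈ S, cutCell δ v) :=
  (Bornology.isBounded_biUnion_finset S).2 fun v _ =>
    isBounded_closedBall.subset (cutCell_subset_closedBall δ v)

/-- A cell domain is bounded. [folklore] -/
theorem isBounded_cellDomain (S : Finset (Site 2)) (δ : ℝ) :
    Bornology.IsBounded (CellDomain S δ) :=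
  (isBounded_iUnion_cutCell S δ).subset interior_subset

/-- The closure of a cell domain lies in the (closed) union of its cells. [folklore] -/
theorem closure_cellDomain_subset (S : Finset (Site 2)) (δ : ℝ) :
    closure (CellDomain S δ) ⊆ ⋃ v ∈ S, cutCell δ v :=
  closure_minimal interior_subset (isClosed_iUnion_cutCell S δ)

/-- Junk values: for `δ ≤ 0` every cell is contained in the singleton `{meshPoint δ v}`, so the
cell domain — an open subset of the plane contained in a finite set — is empty. [folklore] -/
theorem cellDomain_eq_empty (hδ : δ ≤ 0) (S : Finset (Site 2)) : CellDomain S δ = ∅ := by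
  have hsub : CellDomain S δ ⊆ meshPoint δ '' (S : Set (Site 2)) := by
    intro w hw
    obtain ⟨v, hv, h1, h2, -⟩ := exists_mem_cutCell_of_mem_cellDomain hw
    have h1' : 0 ≤ |w.re - (meshPoint δ v).re| := abs_nonneg _
    have h2' : 0 ≤ |w.im - (meshPoint δ v).im| := abs_nonneg _
    refine ⟨v, hv, Complex.ext ?_ ?_⟩
    · have : |w.re - (meshPoint δ v).re| = 0 := by linarith
      rw [abs_eq_zero, sub_eq_zero] at this
      exact this.symm
    · have : |w.im - (meshPoint δ v).im| = 0 := by linarith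
      rw [abs_eq_zero, sub_eq_zero] at this
      exact this.symm
  have hfin : (CellDomain S δ).Finite := (S.finite_toSet.image _).subset hsub
  ext w
  simp only [mem_empty_iff_false, iff_false]
  exact fun hw => infinite_of_mem_nhds w ((isOpen_cellDomain S δ).mem_nhds hw) hfin

/-! ### Mesh vertices of a cell domain -/

/-- The open disc of radius `2δ/5` about the mesh point of a site of `S` lies in the cell
domain. [folklore] -/
theorem ball_subset_cellDomain (hv : v ∈ S) (δ : ℝ) :
    ball (meshPoint δ v) (2 * δ / 5) ⊆ CellDomain S δ :=
  interior_maximal (fun _ hw => mem_iUnion₂.2 ⟨v, hv, ball_subset_cutCell δ v hw⟩) isOpen_ball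

/-- The interior of the cell of a site of `S` lies in the cell domain. [folklore] -/
theorem interior_cutCell_subset_cellDomain (hv : v ∈ S) (δ : ℝ) :
    interior (cutCell δ v) ⊆ CellDomain S δ :=
  interior_mono fun _ hz => mem_iUnion₂.2 ⟨v, hv, hz⟩

/-- For `δ > 0` the mesh point of a site lies in the interior of its cell. [folklore] -/
theorem meshPoint_mem_interior_cutCell (hδ : 0 < δ) (v : Site 2) :
    meshPoint δ v ∈ interior (cutCell δ v) :=
  interior_maximal (ball_subset_cutCell δ v) isOpen_ball (mem_ball_self (by positivity))

/-- For `δ > 0` the mesh points of the sites of `S` lie in the cell domain. [folklore] -/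
theorem meshPoint_mem_cellDomain (hδ : 0 < δ) (hv : v ∈ S) : meshPoint δ v ∈ CellDomain S δ :=
  ball_subset_cellDomain hv δ (mem_ball_self (by positivity))

/-- **The mesh vertices of a cell domain are exactly `S`** (`δ > 0`): `u` is a mesh vertex of
`CellDomain S δ` iff `u ∈ S`. [folklore] -/
theorem mem_meshVertices_cellDomain_iff (hδ : 0 < δ) :
    u ∈ meshVertices (CellDomain S δ) δ ↔ u ∈ S := by
  refine ⟨fun h => ?_, fun h => meshPoint_mem_cellDomain hδ h⟩
  obtain ⟨v, hv, huv⟩ := exists_mem_cutCell_of_mem_cellDomain (mem_meshVertices_iff.1 h)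
  rwa [eq_of_meshPoint_mem_cutCell hδ huv]

/-- **The mesh vertices of a cell domain are exactly `S`** (`δ > 0`), as an equality of sets.
[folklore] -/
theorem meshVertices_cellDomain (hδ : 0 < δ) (S : Finset (Site 2)) :
    meshVertices (CellDomain S δ) δ = ↑S :=
  Set.ext fun _ => mem_meshVertices_cellDomain_iff hδ

/-- For `δ > 0` the cell domain is nonempty iff `S` is. [folklore] -/
theorem cellDomain_nonempty_iff (hδ : 0 < δ) : (CellDomain S δ).Nonempty ↔ S.Nonempty := by
  refine ⟨fun ⟨w, hw⟩ => ?_, fun ⟨v, hv⟩ => ⟨_, meshPoint_mem_cellDomain hδ hv⟩⟩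
  obtain ⟨v, hv, -⟩ := exists_mem_cutCell_of_mem_cellDomain hw
  exact ⟨v, hv⟩

end Literature.Probability.LatticeModels
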